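import Summits.ABC.IUTFork.Thm311RealInd1StripTwistJWFirstPlanes
import Summits.ABC.IUTFork.Thm311RealInd1StripTwistOrthogonality
import HarnessLib

/-!
# [IUTchIII] Thm 3.11 (i) (Ind1) at a QUADRATIC `K_v`: the shear of print's strip part either INFLATES an ideal-shaped region or is
# `v`-adically SHORT — region-rigidity at `d = 2` is ONE norm inequality, which print does not pin (modulo `JannsenWingbergTwistsFirst`)

PROOF-ONLY file (abc-iut cell, Cor. 3.12 sub-crew, seat abc-iut-c312-1 = holder of record of the typed [IUTchIII] Thm. 3.11,
gen 12; row «R14 FIRST-PLANE TWIST», part g).  TAKES NO SIDE on [IUTchIII] Cor. 3.12.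

At every finite place `v ∣ p` (`p` odd) with `[K_v : ℚ_p] = 2`, part c (`Thm311RealInd1StripTwistJWFirstPlanes`, p502329) puts the shear
`ψ₀(x) = x + y_1^*(x)·y_0` along the trace-zero line `ℚ_p·y_0 = Ker(Tr)` in print's (Ind1) strip part `Real.ind1StripOf v (Real.galoisLog v)`,
modulo the named fact.  Gen 10's single-transvection criterion (`TwistLattice.forall_stable_piBall_iff_norm_smul_le`, p482989: a transvection
`x ↦ x + c(x)·y` stabilises every ball `𝔪_v^m` iff `‖c(x)·y‖ ≤ ‖x‖` for all `x`) then LOCATES the region question at `d = 2`: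
* **`Real.quadratic_shear_mapsOut_or_short_of_jannsenWingbergFirst`** — EITHER some `𝔪_v^m = B(0, ‖ϖ‖^m)` (abc-iut-S7's rescaled norm,
  `ϖ` a uniformizer) contains a point carried OUT of it by `ψ₀` (print's (Ind1) strip part strictly inflates an ideal-shaped region at the
  quadratic place), OR the shear is `v`-adically SHORT: `‖y_1^*(x)·y_0‖ ≤ ‖x‖` for all `x`, and then `ψ₀` maps EVERY `𝔪_v^m` into itself;
* `Real.quadratic_shear_stable_iff_short` — for the realised shear: (every `𝔪_v^m` mapped into itself) ⟺ short.
Reading for the record (neutral, OUR typed objects, one place; concordant with Team R's `v₇` dichotomy `psiHN_image_M2_iff`, abc-iut-c312-14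
p481593, now realised modulo the fact by `Thm311RealInd1UnitsHNRealisedJW`, p504153): at a quadratic `K_v` the only datum deciding whether
print's (Ind1) strip part inflates ideal-shaped regions is the `v`-adic size of the shear coefficient `y_1^* ⊗ y_0` of the Jannsen–Wingberg
log-basis — a datum the presentation (NSW 7.5.14 / Hoshi–Nishio / Kondo) does not pin.  HONEST SCOPE: conditional on `JannsenWingbergTwistsFirst`;
nothing here asserts or refutes [IUTchIII] Cor. 3.12; NO abc claim.  [claim: Mochizuki2012, status: disputed];
[cite: HoshiNishio2022OuterAutMLF, Thm 1.5]; [cite: Kondo2025OuterAutMLF, §2 proof of Thm 2.3 (case d_k = 2) p.10]; [cite: DupuyHilado2025, §4.7].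
typed ≠ proved; a conditional theorem discharges nothing it binds.
-/

set_option autoImplicit false

noncomputable section

open Metric Set
open scoped Pointwise

namespace Summit.ABC.IUTFork.Thm311.Real

open NumberField IsDedekindDomain Literature.NumberTheory.NumberFields Literature.IUT.LogVolume
open Literature.NumberTheory.GaloisRepresentations Literature.NumberTheory.GaloisRepresentations.Ultrametric
open Literature.AnabelianGeometry.AbsoluteAnabelian Literature.IUT.HodgeArakelov
open Summit.ABC.IUTFork.Thm311.TwistLattice

variable {F : Type} [Field F] [NumberField F] (v : HeightOneSpectrum (𝓞 F))

/-- Balls of the uniformizer filtration are the closed balls `B(0, ‖ϖ‖^m)` of the rescaled norm. [folklore] -/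
theorem mem_piBall_zpow_iff_mem_closedBall {K : Type*} [NontriviallyNormedField K] [IsUltrametricDist K]
    (ϖ : Kˣ) (m : ℤ) (x : K) :
    x ∈ (piBall (ϖ ^ m) : OpenAddSubgroup K).toAddSubgroup ↔ x ∈ closedBall (0 : K) (‖(ϖ : K)‖ ^ m) := by
  rw [mem_toAddSubgroup_piBall, mem_closedBall_zero_iff, Units.val_zpow_eq_zpow_val, norm_zpow]

/-- **THE QUADRATIC DICHOTOMY.**  Assume `JannsenWingbergTwistsFirst`.  At a finite place `v ∣ p` of a number field with `p` odd and
`[K_v : ℚ_p] = 2`, for any uniformizer `ϖ` of `K_v^{(1/n_v)}`: there are a `ℚ_p`-basis `(y_0, y_1)` and the realised shear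
`ψ₀ ∈ Real.ind1StripOf v (Real.galoisLog v)`, `ψ₀(x) = x + y_1^*(x)·y_0` with `Tr(y_0) = 0`, such that EITHER some point of some
`𝔪_v^m = B(0, ‖ϖ‖^m)` is carried OUT of `𝔪_v^m` by `ψ₀`, OR the shear is `v`-adically short (`‖y_1^*(x)·y_0‖ ≤ ‖x‖` for all `x`) and maps
every `𝔪_v^m` into itself.  Which horn holds is NOT pinned by print. [claim: Mochizuki2012, status: disputed]
[cite: HoshiNishio2022OuterAutMLF, Thm 1.5] [cite: Kondo2025OuterAutMLF, §2 proof of Thm 2.3 (case d_k = 2) p.10] [cite: DupuyHilado2025, §4.7] -/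
theorem quadratic_shear_mapsOut_or_short_of_jannsenWingbergFirst (hJW : JannsenWingbergTwistsFirst)
    (p : ℕ) [Fact p.Prime] (hv : ((p : ℕ) : 𝓞 F) ∈ v.asIdeal) (hp2 : p ≠ 2) (hd : localDeg F v = 2)
    {ϖ : (RescaledCompletion F p v hv)ˣ} (hϖ : IsUniformizer ϖ) :
    ∃ (y : Module.Basis (Fin 2) ℚ_[p] (RescaledCompletion F p v hv)) (ψ₀ : v.adicCompletion F ≃+ v.adicCompletion F),
      ψ₀ ∈ ind1StripOf v (galoisLog v) ∧
      (∀ x : RescaledCompletion F p v hv,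
        RescaledCompletion.of F p v hv (ψ₀ ((RescaledCompletion.of F p v hv).symm x)) = x + y.coord 1 x • y 0) ∧
      Algebra.trace ℚ_[p] (RescaledCompletion F p v hv) (y 0) = 0 ∧
      ((∃ m : ℤ, ∃ x ∈ closedBall (0 : RescaledCompletion F p v hv) (‖(ϖ : RescaledCompletion F p v hv)‖ ^ m),
          RescaledCompletion.of F p v hv (ψ₀ ((RescaledCompletion.of F p v hv).symm x)) ∉
            closedBall (0 : RescaledCompletion F p v hv) (‖(ϖ : RescaledCompletion F p v hv)‖ ^ m)) ∨
        ((∀ x : RescaledCompletion F p v hv, ‖y.coord 1 x • y 0‖ ≤ ‖x‖) ∧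
          ∀ m : ℤ, ∀ x ∈ closedBall (0 : RescaledCompletion F p v hv) (‖(ϖ : RescaledCompletion F p v hv)‖ ^ m),
            RescaledCompletion.of F p v hv (ψ₀ ((RescaledCompletion.of F p v hv).symm x)) ∈
              closedBall (0 : RescaledCompletion F p v hv) (‖(ϖ : RescaledCompletion F p v hv)‖ ^ m))) := by
  obtain ⟨y, ψ₀, hψ₀, hT₀, ht0, -, -⟩ := exists_shear_of_jannsenWingbergFirst_of_localDeg_eq_two v hJW p hv hp2 hd
  refine ⟨y, ψ₀, hψ₀, hT₀, ht0, ?_⟩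
  by_cases hshort : ∀ x : RescaledCompletion F p v hv, ‖y.coord 1 x • y 0‖ ≤ ‖x‖
  · refine Or.inr ⟨hshort, fun m x hx => ?_⟩
    have h := (forall_stable_piBall_iff_norm_smul_le hϖ (y.coord 1) (y 0)).mpr hshort m x
      ((mem_piBall_zpow_iff_mem_closedBall ϖ m x).mpr hx)
    rw [hT₀, ← mem_piBall_zpow_iff_mem_closedBall]
    exact h
  · left
    rw [← forall_stable_piBall_iff_norm_smul_le hϖ (y.coord 1) (y 0)] at hshort
    push Not at hshort
    obtain ⟨m, x, hx, hout⟩ := hshort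
    refine ⟨m, x, (mem_piBall_zpow_iff_mem_closedBall ϖ m x).mp hx, ?_⟩
    rw [hT₀, ← mem_piBall_zpow_iff_mem_closedBall]
    exact hout

/-- **Region-rigidity of the realised quadratic shear is ONE norm inequality**: for `ψ₀(x) = x + c(x)·y_0` as in the dichotomy (any
`ℚ_p`-linear `c`, any `y_0`), `ψ₀` maps every `𝔪_v^m = B(0, ‖ϖ‖^m)` into itself IFF `‖c(x)·y_0‖ ≤ ‖x‖` for all `x` (gen 10's criterion
read on closed balls). [folklore] [cite: DupuyHilado2025, §4.7] -/
theorem quadratic_shear_stable_iff_short (p : ℕ) [Fact p.Prime] (hv : ((p : ℕ) : 𝓞 F) ∈ v.asIdeal)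
    {ϖ : (RescaledCompletion F p v hv)ˣ} (hϖ : IsUniformizer ϖ)
    (c : RescaledCompletion F p v hv →ₗ[ℚ_[p]] ℚ_[p]) (y₀ : RescaledCompletion F p v hv)
    {ψ₀ : v.adicCompletion F ≃+ v.adicCompletion F}
    (hT₀ : ∀ x : RescaledCompletion F p v hv,
      RescaledCompletion.of F p v hv (ψ₀ ((RescaledCompletion.of F p v hv).symm x)) = x + c x • y₀) :
    (∀ m : ℤ, ∀ x ∈ closedBall (0 : RescaledCompletion F p v hv) (‖(ϖ : RescaledCompletion F p v hv)‖ ^ m),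
        RescaledCompletion.of F p v hv (ψ₀ ((RescaledCompletion.of F p v hv).symm x)) ∈
          closedBall (0 : RescaledCompletion F p v hv) (‖(ϖ : RescaledCompletion F p v hv)‖ ^ m)) ↔
      ∀ x : RescaledCompletion F p v hv, ‖c x • y₀‖ ≤ ‖x‖ := by
  rw [← forall_stable_piBall_iff_norm_smul_le hϖ c y₀]
  refine forall_congr' fun m => forall_congr' fun x => ?_
  rw [mem_piBall_zpow_iff_mem_closedBall, mem_piBall_zpow_iff_mem_closedBall, hT₀]

end Summit.ABC.IUTFork.Thm311.Real

end
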